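import Summits.Langlands.Langlands.Theses.HeckeFieldDeRham
import Summits.Langlands.Langlands.Theorems.IrreducibilityBySelfDualityReciprocityUpToIrreducibilityCorrespondsConj
import Literature.FieldTheory.AlgClosed.PadicAlgClEquivComplex

/-!
# Line `primeswitch` — crux `HeckeFieldDeRham.ReciprocityModuloDeRham` (stmt-Langlands-17410), crux-strategist gen 1 (alt line)

The finer cut of line `leaves`: its leaf LGC° (local–global compatibility modulo de Rham) is split along the PRIME SWITCH
of route PrimeSwitchSplit, transported modulo de Rham — each place `v ∣ ℓ` is read through an auxiliary prime `ℓ' ∈ {2,3}`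
not below `v`, and Fontaine's `C_WD` for the system of avatars (`stub_conditionalPrimeSwitch`, = `PadicMemberCompatibility`
(ii) with its clause (i) "the avatar is de Rham" moved into the HYPOTHESIS, which is exactly RMD's conditional clause) turns
compatibility of the `ℓ'`-adic avatar at `v` (Grothendieck–Deligne side, `stub_awayFromL`, no geometric hypothesis) into
compatibility of the `ℓ`-adic one through `D_pst`.  Stubs (the ONLY sorries): W⁺ (= stmt-Langlands-17415 verbatim), B_w
(= stmt-Langlands-17414 verbatim), LGC-away° (= stmt-Langlands-17417 with the pinned-geometric hypothesis dropped),
conditional prime switch (∀ `Rec`).  `ReciprocityModuloDeRham_of` kernel-checked, sorry-free; uniqueness of (A°) in the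
seam by the landed `isConjugate_of_satakeFrobCompatibleAt` (p119850).
-/

set_option linter.dupNamespace false

namespace Summit.Langlands.Langlands.Cruxes.ReciprocityModuloDeRham.PrimeSwitch

open scoped BigOperators Topology Manifold Classical MeasureTheory ProbabilityTheory Matrix InnerProductSpace ComplexConjugate ContinuousMap
open Filter Set Function TopologicalSpace MeasureTheory
open Summit.Langlands Summit.Langlands.Langlands.Theses.HeckeFieldDeRham

/-- **W⁺ — irreducible Satake-level avatar (OPEN; VERBATIM stmt-Langlands-17415).** [cite: BuzzardGeeLMS2014, Conj. 3.2.2] -/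
theorem stub_satakeAvatarExistence :
    ∀ (K : Type) [Field K] [NumberField K] (n : ℕ) (hcpt : Literature.NumberTheory.Automorphic.isCompact_glFiniteIntegralLevel n K), 0 < n → ∀ (π : Literature.NumberTheory.Automorphic.CuspidalAutomorphicRepData n K hcpt), π.1.IsLAlgebraic → ∀ (ℓ : ℕ) [Fact ℓ.Prime] (ι : PadicAlgCl ℓ ≃+* ℂ), ∃ ρ : Literature.NumberTheory.GaloisRepresentations.FramedGaloisRep K (PadicAlgCl ℓ) n, ρ.toGaloisRep.IsIrreducible ∧ ∀ᶠ v : IsDedekindDomain.HeightOneSpectrum (NumberField.RingOfIntegers K) in cofinite, SatakeFrobCompatibleAt ι π.1 ρ v := by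
  sorry

/-- **B_w — weak geometric automorphy (OPEN; VERBATIM stmt-Langlands-17414).** [cite: FontaineMazurGeometric1995, Conj. 1] -/
theorem stub_weakGeometricAutomorphy :
    ∀ (K : Type) [Field K] [NumberField K] (n : ℕ) (hcpt : Literature.NumberTheory.Automorphic.isCompact_glFiniteIntegralLevel n K), 0 < n → ∀ (ℓ : ℕ) [Fact ℓ.Prime] (ι : PadicAlgCl ℓ ≃+* ℂ) (ρ : Literature.NumberTheory.GaloisRepresentations.FramedGaloisRep K (PadicAlgCl ℓ) n), ρ.toGaloisRep.IsIrreducible → ((∀ᶠ v : IsDedekindDomain.HeightOneSpectrum (NumberField.RingOfIntegers K) in cofinite, ρ.IsUnramifiedAt v) ∧ ∀ (v : IsDedekindDomain.HeightOneSpectrum (NumberField.RingOfIntegers K)) (hv : ((ℓ : ℕ) : NumberField.RingOfIntegers K) ∈ v.asIdeal), (Literature.NumberTheory.PAdicHodge.fontainePstAdicCompletion v ℓ hv).IsDeRhamFramed (ρ.toLocal v)) → ∃ π : Literature.NumberTheory.Automorphic.CuspidalAutomorphicRepData n K hcpt, π.1.IsLAlgebraic ∧ ∀ᶠ v : IsDedekindDomain.HeightOneSpectrum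 (NumberField.RingOfIntegers K) in cofinite, SatakeFrobCompatibleAt ι π.1 ρ v := by
  sorry

/-- **LGC-away° (OPEN): Taylor 2004 Conj. 7 at `v ∤ ℓ` for IRREDUCIBLE Satake-compatible pairs, one `Rec` per field, NO
geometric hypothesis** (= stmt-Langlands-17417 `CompatibilityAwayFromL` with the pinned-geometric hypothesis dropped; still a
consequence of the summit by avatar conjugacy).  Carayol, Harris–Taylor Thm. A/B, Taylor–Yoshida, Caraiani; Varma 2024 up to
monodromy `≺` for regular `π` over CM. [cite: HarrisTaylorAMS2001, Thm. A] [cite: VarmaFMS2024, Thm. 1] -/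
theorem stub_awayFromL :
    ∀ (K : Type) [Field K] [NumberField K], ∃ Rec : ReciprocityData K, ∀ (n : ℕ) (hcpt : Literature.NumberTheory.Automorphic.isCompact_glFiniteIntegralLevel n K), 0 < n → ∀ (π : Literature.NumberTheory.Automorphic.CuspidalAutomorphicRepData n K hcpt), π.1.IsLAlgebraic → ∀ (ℓ : ℕ) [Fact ℓ.Prime] (ι : PadicAlgCl ℓ ≃+* ℂ) (ρ : Literature.NumberTheory.GaloisRepresentations.FramedGaloisRep K (PadicAlgCl ℓ) n), ρ.toGaloisRep.IsIrreducible → (∀ᶠ v : IsDedekindDomain.HeightOneSpectrum (NumberField.RingOfIntegers K) in cofinite, SatakeFrobCompatibleAt ι π.1 ρ v) → ∀ v : IsDedekindDomain.HeightOneSpectrum (NumberField.RingOfIntegers K), ((ℓ : ℕ) : NumberField.RingOfIntegers K) ∉ v.asIdeal → LocalGlobalCompatibleAt Rec ι π.1 ρ v := by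
  sorry

/-- **Conditional prime switch (OPEN): Fontaine's `C_WD` for the system of avatars, for EVERY datum** (= stmt-Langlands-17534
`PadicMemberCompatibility` (ii) with (i) as hypothesis): if the irreducible `ℓ`-adic avatar `ρ` of `π` is de Rham at `v ∣ ℓ`,
compatibility at `v` of any irreducible `ℓ'`-adic avatar `ρ'` (`ℓ' ∤ v`) transfers to `(π, ρ)` at `v`.  Known semisimplified for
regular `π` over CM (A'Campo–Hevesi–Thorne–Whitmore) and for Shimura-variety motives (Saito, Caraiani); OPEN in general.
[cite: FontaineAsterisque223VIII, §2.3.7] [cite: HarrisTaylorAMS2001, Thm. A] -/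
theorem stub_conditionalPrimeSwitch :
    ∀ (K : Type) [Field K] [NumberField K] (Rec : ReciprocityData K) (n : ℕ) (hcpt : Literature.NumberTheory.Automorphic.isCompact_glFiniteIntegralLevel n K), 0 < n → ∀ (π : Literature.NumberTheory.Automorphic.CuspidalAutomorphicRepData n K hcpt), π.1.IsLAlgebraic → ∀ (ℓ : ℕ) [Fact ℓ.Prime] (ι : PadicAlgCl ℓ ≃+* ℂ) (ρ : Literature.NumberTheory.GaloisRepresentations.FramedGaloisRep K (PadicAlgCl ℓ) n), ρ.toGaloisRep.IsIrreducible → (∀ᶠ v : IsDedekindDomain.HeightOneSpectrum (NumberField.RingOfIntegers K) in cofinite, SatakeFrobCompatibleAt ι π.1 ρ v) → ∀ (v : IsDedekindDomain.HeightOneSpectrum (NumberField.RingOfIntegers K)) (hv : ((ℓ : ℕ) : NumberField.RingOfIntegers K) ∈ v.asIdeal), (Rec.pst ℓ v hv).IsDeRhamFramed (ρ.toLocal v) → ∀ (ℓ' : ℕ) [Fact ℓ'.Prime] (ι' : PadicAlgCl ℓ' ≃+* ℂ) (ρ' : Literature.NumberTheory.GaloisRepresentations.FramedGaloisRep K (PadicAlgCl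 ℓ') n), ((ℓ' : ℕ) : NumberField.RingOfIntegers K) ∉ v.asIdeal → ρ'.toGaloisRep.IsIrreducible → (∀ᶠ w : IsDedekindDomain.HeightOneSpectrum (NumberField.RingOfIntegers K) in cofinite, SatakeFrobCompatibleAt ι' π.1 ρ' w) → LocalGlobalCompatibleAt Rec ι' π.1 ρ' v → LocalGlobalCompatibleAt Rec ι π.1 ρ v := by
  sorry

/-- **Composition (sorry-free): W⁺ → B_w → LGC-away° → conditional prime switch → `ReciprocityModuloDeRham`, BY NAME.**
`Rec` := the datum of LGC-away°.  Local–global compatibility at `v` for an irreducible avatar `ρ` that is de Rham at `v` if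
`v ∣ ℓ`: away from `ℓ` by the away stub; at `v ∣ ℓ` pick `ℓ' ∈ {2,3}` with `ℓ' ∉ v` (`3 - 2 = 1`), `ι'` by
`PadicAlgCl.nonempty_ringEquiv_complex`, `ρ'` from W⁺, its compatibility at `v` from the away stub, then the switch.  (A°) and
(B) are then assembled exactly as in line `leaves` (uniqueness by `isConjugate_of_satakeFrobCompatibleAt`).
[cite: BuzzardGeeLMS2014, Conj. 3.2.2] -/
theorem ReciprocityModuloDeRham_of :
    (∀ (K : Type) [Field K] [NumberField K] (n : ℕ) (hcpt : Literature.NumberTheory.Automorphic.isCompact_glFiniteIntegralLevel n K), 0 < n → ∀ (π : Literature.NumberTheory.Automorphic.CuspidalAutomorphicRepData n K hcpt), π.1.IsLAlgebraic → ∀ (ℓ : ℕ) [Fact ℓ.Prime] (ι : PadicAlgCl ℓ ≃+* ℂ), ∃ ρ : Literature.NumberTheory.GaloisRepresentations.FramedGaloisRep K (PadicAlgCl ℓ) n, ρ.toGaloisRep.IsIrreducible ∧ ∀ᶠ v : IsDedekindDomain.HeightOneSpectrum (NumberField.RingOfIntegers K) in cofinite, SatakeFrobCompatibleAt ι π.1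 ρ v) →
    (∀ (K : Type) [Field K] [NumberField K] (n : ℕ) (hcpt : Literature.NumberTheory.Automorphic.isCompact_glFiniteIntegralLevel n K), 0 < n → ∀ (ℓ : ℕ) [Fact ℓ.Prime] (ι : PadicAlgCl ℓ ≃+* ℂ) (ρ : Literature.NumberTheory.GaloisRepresentations.FramedGaloisRep K (PadicAlgCl ℓ) n), ρ.toGaloisRep.IsIrreducible → ((∀ᶠ v : IsDedekindDomain.HeightOneSpectrum (NumberField.RingOfIntegers K) in cofinite, ρ.IsUnramifiedAt v) ∧ ∀ (v : IsDedekindDomain.HeightOneSpectrum (NumberField.RingOfIntegers K)) (hv : ((ℓ : ℕ) : NumberField.RingOfIntegers K) ∈ v.asIdeal), (Literature.NumberTheory.PAdicHodge.fontainePstAdicCompletion v ℓ hv).IsDeRhamFramed (ρ.toLocal v)) → ∃ π : Literature.NumberTheory.Automorphic.CuspidalAutomorphicRepData n K hcpt, π.1.IsLAlgebraic ∧ ∀ᶠ v : IsDedekindDomain.HeightOneSpectrum (NumberField.RingOfIntegers K) in cofinite, SatakeFrobCompatibleAt ι π.1 ρ v) →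
    (∀ (K : Type) [Field K] [NumberField K], ∃ Rec : ReciprocityData K, ∀ (n : ℕ) (hcpt : Literature.NumberTheory.Automorphic.isCompact_glFiniteIntegralLevel n K), 0 < n → ∀ (π : Literature.NumberTheory.Automorphic.CuspidalAutomorphicRepData n K hcpt), π.1.IsLAlgebraic → ∀ (ℓ : ℕ) [Fact ℓ.Prime] (ι : PadicAlgCl ℓ ≃+* ℂ) (ρ : Literature.NumberTheory.GaloisRepresentations.FramedGaloisRep K (PadicAlgCl ℓ) n), ρ.toGaloisRep.IsIrreducible → (∀ᶠ v : IsDedekindDomain.HeightOneSpectrum (NumberField.RingOfIntegers K) in cofinite, SatakeFrobCompatibleAt ι π.1 ρ v) → ∀ v : IsDedekindDomain.HeightOneSpectrum (NumberField.RingOfIntegers K), ((ℓ : ℕ) : NumberField.RingOfIntegers K) ∉ v.asIdeal → LocalGlobalCompatibleAt Rec ι π.1 ρ v) →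
    (∀ (K : Type) [Field K] [NumberField K] (Rec : ReciprocityData K) (n : ℕ) (hcpt : Literature.NumberTheory.Automorphic.isCompact_glFiniteIntegralLevel n K), 0 < n → ∀ (π : Literature.NumberTheory.Automorphic.CuspidalAutomorphicRepData n K hcpt), π.1.IsLAlgebraic → ∀ (ℓ : ℕ) [Fact ℓ.Prime] (ι : PadicAlgCl ℓ ≃+* ℂ) (ρ : Literature.NumberTheory.GaloisRepresentations.FramedGaloisRep K (PadicAlgCl ℓ) n), ρ.toGaloisRep.IsIrreducible → (∀ᶠ v : IsDedekindDomain.HeightOneSpectrum (NumberField.RingOfIntegers K) in cofinite, SatakeFrobCompatibleAt ι π.1 ρ v) → ∀ (v : IsDedekindDomain.HeightOneSpectrum (NumberField.RingOfIntegers K)) (hv : ((ℓ : ℕ) : NumberField.RingOfIntegers K) ∈ v.asIdeal), (Rec.pst ℓ v hv).IsDeRhamFramed (ρ.toLocal v) → ∀ (ℓ' : ℕ) [Fact ℓ'.Prime] (ι' : PadicAlgCl ℓ' ≃+* ℂ) (ρ' : Literature.NumberTheory.GaloisRepresentations.FramedGaloisRep K (PadicAlgCl ℓ') n), ((ℓ'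 : ℕ) : NumberField.RingOfIntegers K) ∉ v.asIdeal → ρ'.toGaloisRep.IsIrreducible → (∀ᶠ w : IsDedekindDomain.HeightOneSpectrum (NumberField.RingOfIntegers K) in cofinite, SatakeFrobCompatibleAt ι' π.1 ρ' w) → LocalGlobalCompatibleAt Rec ι' π.1 ρ' v → LocalGlobalCompatibleAt Rec ι π.1 ρ v) →
    Summit.Langlands.Langlands.Theses.HeckeFieldDeRham.ReciprocityModuloDeRham := by
  intro hW hB hA hS F _ _
  obtain ⟨Rec, hRec⟩ := hA F
  -- local–global compatibility modulo de Rham at every place, for this `Rec`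
  have hL : ∀ (n : ℕ) (hcpt : Literature.NumberTheory.Automorphic.isCompact_glFiniteIntegralLevel n F), 0 < n →
      ∀ (π : Literature.NumberTheory.Automorphic.CuspidalAutomorphicRepData n F hcpt), π.1.IsLAlgebraic →
      ∀ (ℓ : ℕ) [Fact ℓ.Prime] (ι : PadicAlgCl ℓ ≃+* ℂ)
        (ρ : Literature.NumberTheory.GaloisRepresentations.FramedGaloisRep F (PadicAlgCl ℓ) n), ρ.toGaloisRep.IsIrreducible →
        (∀ᶠ v : IsDedekindDomain.HeightOneSpectrum (NumberField.RingOfIntegers F) in cofinite, SatakeFrobCompatibleAt ι π.1 ρ v) →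
        ∀ v : IsDedekindDomain.HeightOneSpectrum (NumberField.RingOfIntegers F),
          (∀ hv : ((ℓ : ℕ) : NumberField.RingOfIntegers F) ∈ v.asIdeal, (Rec.pst ℓ v hv).IsDeRhamFramed (ρ.toLocal v)) →
          LocalGlobalCompatibleAt Rec ι π.1 ρ v := by
    intro n hcpt hn π hπ ℓ _ ι ρ hirr hsat v hdR
    by_cases hv : ((ℓ : ℕ) : NumberField.RingOfIntegers F) ∈ v.asIdeal
    · have key : ∀ (ℓ' : ℕ) [Fact ℓ'.Prime], ((ℓ' : ℕ) : NumberField.RingOfIntegers F) ∉ v.asIdeal →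
          LocalGlobalCompatibleAt Rec ι π.1 ρ v := by
        intro ℓ' _ hℓ'
        obtain ⟨ι'⟩ := PadicAlgCl.nonempty_ringEquiv_complex ℓ'
        obtain ⟨ρ', hirr', hsat'⟩ := hW F n hcpt hn π hπ ℓ' ι'
        exact hS F Rec n hcpt hn π hπ ℓ ι ρ hirr hsat v hv (hdR hv) ℓ' ι' ρ' hℓ' hirr' hsat'
          (hRec n hcpt hn π hπ ℓ' ι' ρ' hirr' hsat' v hℓ')
      by_cases h2 : ((2 : ℕ) : NumberField.RingOfIntegers F) ∈ v.asIdeal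
      · have h3 : ((3 : ℕ) : NumberField.RingOfIntegers F) ∉ v.asIdeal := by
          intro h3
          apply v.isPrime.ne_top
          rw [Ideal.eq_top_iff_one]
          have h32 : ((3 : ℕ) : NumberField.RingOfIntegers F) - ((2 : ℕ) : NumberField.RingOfIntegers F) = 1 := by
            push_cast; norm_num
          rw [← h32]
          exact v.asIdeal.sub_mem h3 h2
        haveI : Fact (Nat.Prime 3) := ⟨by norm_num⟩
        exact key 3 h3
      · haveI : Fact (Nat.Prime 2) := ⟨by norm_num⟩
        exact key 2 h2
    · exact hRec n hcpt hn π hπ ℓ ι ρ hirr hsat v hv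
  refine ⟨Rec, fun n hn hcpt => ⟨?_, ?_⟩⟩
  · intro π hπ ℓ _ ι
    obtain ⟨ρ, hirr, hsat⟩ := hW F n hcpt hn π hπ ℓ ι
    refine ⟨ρ, hirr, hsat, ?_, ?_, ?_⟩
    · intro v hv
      exact hL n hcpt hn π hπ ℓ ι ρ hirr hsat v (fun hv' => absurd hv' hv)
    · intro v hv hdR
      exact hL n hcpt hn π hπ ℓ ι ρ hirr hsat v (fun _ => hdR)
    · intro ρ' hρ'
      exact Theorems.ReciprocityUpToIrreducibility.isConjugate_of_satakeFrobCompatibleAt π.1 ι hirr hsat hρ'.1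
  · intro ℓ _ ι ρ hirr hgeo
    obtain ⟨π, hπ, hsat⟩ := hB F n hcpt hn ℓ ι ρ hirr ⟨hgeo.1, fun v hv => hgeo.2 v hv⟩
    exact ⟨π, hπ, hsat, fun v => hL n hcpt hn π hπ ℓ ι ρ hirr hsat v (fun hv => hgeo.2 v hv)⟩

/-- The crux modulo exactly the four registered stubs. -/
theorem ReciprocityModuloDeRham_of_stubs :
    Summit.Langlands.Langlands.Theses.HeckeFieldDeRham.ReciprocityModuloDeRham :=
  ReciprocityModuloDeRham_of stub_satakeAvatarExistence stub_weakGeometricAutomorphy stub_awayFromL stub_conditionalPrimeSwitch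

end Summit.Langlands.Langlands.Cruxes.ReciprocityModuloDeRham.PrimeSwitch
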